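import Literature.NumberTheory.IwasawaTheory.ClassGroupPRankLeOneOfAmbiguousLayerTwo
import Literature.NumberTheory.IwasawaTheory.CyclotomicTwoTotallyRamifiedOddIndex
import HarnessLib

/-!
# The DEPTH DOOR with its ramification hypothesis discharged: over an odd-degree field whose dyadic primes have odd `e(w|2)` (e.g. `2 ∤ d_K`), every
# prime above `2` ramifies in every layer `K_m` (`m ≥ 1`) of a cyclotomic `ℤ₂`-extension, so «at least two primes of `K` above `2`» replaces
# «at least two primes of `K` ramified in `K_2`»

Topic `NumberTheory/IwasawaTheory` (namespace = path).  THEOREM-ONLY file (no definition, no named fact, no instance, no `sorry`), written by the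
prover seat `bsd-line-att-p3` g42 (cell `bsd-f1-sign2`, route `AlignedTransportAtTwo`; `--supports` stmt-BirchSwinnertonDyer-22298, closes nothing; no class group
is computed here).  Sequel of `ClassGroupPRankLeOneOfAmbiguousLayerTwo.lean` (this seat: the depth door `classGroupPRank_le_one_of_relIndex_unitsNorm_eq_one`,
whose hypothesis `hs : 2 ≤ #{v : e_v(K_2/K) ≠ 1}` is about the quartic layer) and of `CyclotomicTwoTotallyRamifiedOddIndex.lean` (bsd-2adic: `√2 ∈ K_1`
for a cyclotomic `ℤ₂`-extension of an odd-degree `K`; `e(Q|2)` even when `√2 ∈ L`; odd `e(w|2)` ⟹ `w` ramifies in `K_1` and Fukuda's index is `0`).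

* ★ `ramificationIdxIn_layer_ne_one_of_odd_ramificationIdx` — `2 ∤ [K:ℚ]`, `κ` cyclotomic, `w ∣ 2` with `e(w|2)` odd, `m ≥ 1` ⟹ `e_w(K_m/K) ≠ 1`
  (`√2 ∈ K_1 ⊆ K_m`, so `e(Q|2) = e(w|2)·e(Q|w)` is even for `Q ∣ w` in `K_m`).
* ★ `ncard_dyadic_le_ncard_ramified_layer` — hence `#{w ∣ 2} ≤ #{v : e_v(K_m/K) ≠ 1}` when every `e(w|2)` is odd.
* ★★★ `classGroupPRank_le_one_of_relIndex_unitsNorm_eq_one_of_forall_odd_ramificationIdx` — THE DEPTH DOOR for an odd-degree `K` whose dyadic primes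
  have odd `e(w|2)`: `2 ∤ h_K`, `ord₂ h(K_1) ≤ 1`, AT LEAST TWO PRIMES OF `K` ABOVE `2`, `[E_K : E_K ∩ N_{K_2/K} K_2ˣ] = 1` ⟹ `rank₂ Cl(K_m) ≤ 1 ∀ m`, `μ₂ = 0`,
  `λ₂ ≤ 1` (Fukuda's index `0` is `totallyRamifiedFrom_zero_of_forall_odd_ramificationIdx`); `…_of_not_dvd_discr` — the same from `2 ∤ d_K`.

USE (cell bsd-f1-sign2, crux C2): the cubic `2`-torsion field `ℚ(β)` of a good-ordinary seed with `Δ_min ≡ 1 (mod 4)` has all `e(w|2) = 1` and at least two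
primes above `2` (att-p5 g26 `two_le_ncard_of_isOrdinaryAt_two`), so the door's displayed data shrink to: `h(ℚ(β))` odd, `ord₂ h(ℚ(β,√2)) ≤ 1`, and the unit norm
index `1` (two norm identities).  HONEST SCOPE: classical; nothing specific to any summit; BSD is not advanced by this file.

References: [Washington1997] §13.1 Prop. 13.2, Lemma 13.3, §13.3 Prop. 13.22–13.23; [NeukirchANT1999] Ch. I §8 Prop. (8.2), Ch. III (2.12); [Lang1990] Ch. 13 §4
Lemma 4.1; [Fukuda1994] Thm. 1, p. 264.
-/

set_option autoImplicit false

noncomputable section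

open scoped NumberField
open NumberField IsDedekindDomain Field IntermediateField

namespace Literature.NumberTheory.IwasawaTheory

open Literature.NumberTheory.EllipticCurves Literature.NumberTheory.NumberFields
  Literature.NumberTheory.GaloisRepresentations Literature.NumberTheory.GaloisRepresentations.Herbrand
  Literature.NumberTheory.GaloisRepresentations.MinkowskiUnit Literature.NumberTheory.GaloisRepresentations.CyclicNormIndex

variable {K : Type} [Field K] [NumberField K]

omit [NumberField K] in
/-- A place of `K` containing `2` lies over `(2) ⊂ ℤ`. [folklore] -/
private theorem liesOver_span_two_of_mem' (w : HeightOneSpectrum (𝓞 K)) (hw : ((2 : ℕ) : 𝓞 K) ∈ w.asIdeal) :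
    w.asIdeal.LiesOver (Ideal.span {(2 : ℤ)}) := by
  rw [Ideal.liesOver_span_iff w.isPrime.ne_top Int.prime_two, map_ofNat]
  exact_mod_cast hw

/-! ## §1 Dyadic primes with odd `e(w|2)` ramify in every layer `K_m`, `m ≥ 1` -/

/-- ★ **Odd `e(w|2)` ⟹ `w` ramifies in every layer `K_m`, `m ≥ 1`, of a cyclotomic `ℤ₂`-extension of an odd-degree field.**  `√2 ∈ K_1 ⊆ K_m`
(`exists_sq_eq_two_layer_one_of_not_dvd_finrank`), so for a prime `Q ∣ w` of `𝓞 K_m` the index `e(Q|2) = e(w|2)·e(Q|w)` is even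
(`even_ramificationIdx_int_of_sq_eq_two`); as `e(w|2)` is odd, `e(Q|w)` is even, in particular `e_w(K_m/K) ≠ 1`. [cite: Washington1997, §13.1 Prop. 13.2]
[cite: NeukirchANT1999, Ch. I §8 Prop. (8.2)] -/
theorem ramificationIdxIn_layer_ne_one_of_odd_ramificationIdx (hK : ¬ 2 ∣ Module.finrank ℚ K)
    (κ : ZpExtension K 2) (hκ : κ.IsCyclotomic) {w : HeightOneSpectrum (𝓞 K)}
    (hw : ((2 : ℕ) : 𝓞 K) ∈ w.asIdeal) (hodd : Odd (w.asIdeal.ramificationIdx ℤ)) {m : ℕ} (hm : 1 ≤ m) :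
    w.asIdeal.ramificationIdxIn (𝓞 (κ.layer m)) ≠ 1 := by
  classical
  haveI : FiniteDimensional K (κ.layer m) := κ.finiteDimensional_layer_holds m
  haveI : IsGalois K (κ.layer m) := κ.isGalois_layer_holds m
  haveI : NumberField (κ.layer m) := NumberField.of_module_finite K _
  -- `√2 ∈ K_1 ⊆ K_m`
  obtain ⟨θ, hθ⟩ := exists_sq_eq_two_layer_one_of_not_dvd_finrank hK κ hκ
  have hle : κ.layer 1 ≤ κ.layer m := κ.layer_mono hm
  obtain ⟨θm, hθmval⟩ : ∃ θm : κ.layer m, (θm : AlgebraicClosure K) = (θ : AlgebraicClosure K) :=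
    ⟨⟨(θ : AlgebraicClosure K), hle θ.2⟩, rfl⟩
  have hθ' : ((θ : κ.layer 1) : AlgebraicClosure K) ^ 2 = 2 := by
    have h := congrArg (fun z : κ.layer 1 => ((z : κ.layer 1) : AlgebraicClosure K)) hθ
    push_cast at h
    exact h
  have hθm2 : θm ^ 2 = 2 := by
    apply Subtype.ext
    push_cast
    rw [hθmval]
    exact hθ' 
  -- a prime `Q ∣ w` of `K_m`
  haveI : w.asIdeal.IsPrime := w.isPrime
  haveI := liesOver_span_two_of_mem' w hw
  obtain ⟨⟨Q, hQprime, hQover⟩⟩ :=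
    (inferInstance : Nonempty (Ideal.primesOver w.asIdeal (𝓞 (κ.layer m))))
  haveI := hQprime
  haveI := hQover
  haveI : Q.LiesOver (Ideal.span {(2 : ℤ)}) := Ideal.LiesOver.trans Q w.asIdeal _
  have heven := even_ramificationIdx_int_of_sq_eq_two hθm2 Q
  rw [Ideal.ramificationIdx_tower w.asIdeal Q] at heven
  intro h1
  rw [Ideal.ramificationIdxIn_eq_ramificationIdx w.asIdeal Q ((κ.layer m) ≃ₐ[K] (κ.layer m))] at h1
  rw [h1, mul_one] at heven
  exact (Nat.not_even_iff_odd.mpr hodd) heven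

/-- ★ **`#{w ∣ 2} ≤ #{v : e_v(K_m/K) ≠ 1}`** (`m ≥ 1`) for a cyclotomic `ℤ₂`-extension of an odd-degree `K` all of whose dyadic primes have odd `e(w|2)`:
every prime above `2` ramifies in `K_m` (§1), and the ramified set is finite. [cite: Washington1997, §13.1 Prop. 13.2] [cite: NeukirchANT1999, Ch. III §2 Thm. (2.6)] -/
theorem ncard_dyadic_le_ncard_ramified_layer (hK : ¬ 2 ∣ Module.finrank ℚ K)
    (κ : ZpExtension K 2) (hκ : κ.IsCyclotomic)
    (hodd : ∀ w : HeightOneSpectrum (𝓞 K), ((2 : ℕ) : 𝓞 K) ∈ w.asIdeal → Odd (w.asIdeal.ramificationIdx ℤ))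
    {m : ℕ} (hm : 1 ≤ m) :
    {w : HeightOneSpectrum (𝓞 K) | ((2 : ℕ) : 𝓞 K) ∈ w.asIdeal}.ncard ≤
      {v : HeightOneSpectrum (𝓞 K) | v.asIdeal.ramificationIdxIn (𝓞 (κ.layer m)) ≠ 1}.ncard := by
  haveI : FiniteDimensional K (κ.layer m) := κ.finiteDimensional_layer_holds m
  haveI : IsGalois K (κ.layer m) := κ.isGalois_layer_holds m
  haveI : NumberField (κ.layer m) := NumberField.of_module_finite K _
  refine Set.ncard_le_ncard (fun w hw => ?_) (AmbiguousIdeal.finite_setOf_ramificationIdxIn_ne_one (K := K) (L := κ.layer m))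
  exact ramificationIdxIn_layer_ne_one_of_odd_ramificationIdx hK κ hκ hw (hodd w hw) hm

/-- `2 ∤ d_K` ⟹ every `e(w|2) = 1` is odd (Mathlib `NumberField.not_dvd_discr_iff_isUnramifiedIn`). [cite: NeukirchANT1999, Ch. III (2.12)] -/
theorem forall_odd_ramificationIdx_of_not_dvd_discr (hd : ¬ (2 : ℤ) ∣ NumberField.discr K) :
    ∀ w : HeightOneSpectrum (𝓞 K), ((2 : ℕ) : 𝓞 K) ∈ w.asIdeal → Odd (w.asIdeal.ramificationIdx ℤ) := by
  intro w hw
  have hunr : Algebra.IsUnramifiedIn (𝓞 K) (Ideal.span {(2 : ℤ)}) :=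
    (NumberField.not_dvd_discr_iff_isUnramifiedIn K (𝓞 K) Int.prime_two).mp hd
  haveI : w.asIdeal.IsPrime := w.isPrime
  haveI := liesOver_span_two_of_mem' w hw
  rw [hunr.ramificationIdx_eq_one (𝔓 := w.asIdeal) inferInstance]
  exact odd_one

/-! ## §2 The depth door with «two primes above `2`» -/

/-- ★★★ **THE DEPTH DOOR for an odd-degree field whose dyadic primes have odd `e(w|2)`.**  `K` with `2 ∤ [K:ℚ]`, `κ` a cyclotomic `ℤ₂`-extension,
every `w ∣ 2` with `e(w|2)` odd (so Fukuda's index is `0`, `totallyRamifiedFrom_zero_of_forall_odd_ramificationIdx`, and every `w ∣ 2` ramifies in `K_2`);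
`2 ∤ h_K`, `ord₂ h(K_1) ≤ 1`, AT LEAST TWO primes of `K` above `2`, and `[E_K : E_K ∩ N_{K_2/K} K_2ˣ] = 1` inside `K_2ˣ`.  THEN `rank₂ Cl(K_m) ≤ 1` for every
`m`, `μ₂(κ) = 0`, `λ₂(κ) ≤ 1`. [cite: Washington1997, §13.3 Prop. 13.22–13.23] [cite: Lang1990, Ch. 13 §4, Lemma 4.1 (PDF pp. 203–204)]
[cite: Fukuda1994, Thm. 1, p. 264] [cite: NeukirchANT1999, Ch. IV §6 and Ch. VI §7 Thm. (7.1)] -/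
theorem classGroupPRank_le_one_of_relIndex_unitsNorm_eq_one_of_forall_odd_ramificationIdx (hK : ¬ 2 ∣ Module.finrank ℚ K)
    (κ : ZpExtension K 2) (hκ : κ.IsCyclotomic)
    (hodd : ∀ w : HeightOneSpectrum (𝓞 K), ((2 : ℕ) : 𝓞 K) ∈ w.asIdeal → Odd (w.asIdeal.ramificationIdx ℤ))
    (hh : ¬ 2 ∣ classNumber K) (he1 : classNumberPExp κ 1 ≤ 1)
    (h2 : 2 ≤ {w : HeightOneSpectrum (𝓞 K) | ((2 : ℕ) : 𝓞 K) ∈ w.asIdeal}.ncard) [NumberField (κ.layer 2)]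
    (hidx : (unitsE (κ.layer 2) ⊓ (⊤ : Subgroup (κ.layer 2)ˣ).map
        (Herbrand.norm ((κ.layer 2) ≃ₐ[K] (κ.layer 2)))).relIndex
        (unitsE (κ.layer 2) ⊓ (unitsIncl K (κ.layer 2)).range) = 1) :
    (∀ m, classGroupPRank κ m ≤ 1) ∧ ClassicalMuVanishes κ ∧ classicalLambda κ ≤ 1 :=
  classGroupPRank_le_one_of_relIndex_unitsNorm_eq_one κ (totallyRamifiedFrom_zero_of_forall_odd_ramificationIdx hK κ hκ hodd) hh he1
    (h2.trans (ncard_dyadic_le_ncard_ramified_layer hK κ hκ hodd (by norm_num : 1 ≤ 2))) hidx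

/-- ★★★ **THE DEPTH DOOR for an odd-degree field of odd discriminant** (`2 ∤ [K:ℚ]`, `2 ∤ d_K`): `2 ∤ h_K`, `ord₂ h(K_1) ≤ 1`, at least two primes above `2`,
`[E_K : E_K ∩ N_{K_2/K} K_2ˣ] = 1` ⟹ `rank₂ Cl(K_m) ≤ 1 ∀ m`, `μ₂ = 0`, `λ₂ ≤ 1`, for the cyclotomic `ℤ₂`-extension `κ`.  (Cubic `2`-torsion fields `ℚ(β)`
with `Δ_W ≡ 5 (mod 8)`: `2 = 𝔭₁𝔭₂`, `E = ⟨−1, ε⟩`.) [cite: Washington1997, §13.3 Prop. 13.22–13.23] [cite: Lang1990, Ch. 13 §4, Lemma 4.1 (PDF pp. 203–204)]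
[cite: NeukirchANT1999, Ch. III (2.12)] [cite: Fukuda1994, Thm. 1, p. 264] -/
theorem classGroupPRank_le_one_of_relIndex_unitsNorm_eq_one_of_not_dvd_discr (hK : ¬ 2 ∣ Module.finrank ℚ K)
    (hd : ¬ (2 : ℤ) ∣ NumberField.discr K) (κ : ZpExtension K 2) (hκ : κ.IsCyclotomic)
    (hh : ¬ 2 ∣ classNumber K) (he1 : classNumberPExp κ 1 ≤ 1)
    (h2 : 2 ≤ {w : HeightOneSpectrum (𝓞 K) | ((2 : ℕ) : 𝓞 K) ∈ w.asIdeal}.ncard) [NumberField (κ.layer 2)]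
    (hidx : (unitsE (κ.layer 2) ⊓ (⊤ : Subgroup (κ.layer 2)ˣ).map
        (Herbrand.norm ((κ.layer 2) ≃ₐ[K] (κ.layer 2)))).relIndex
        (unitsE (κ.layer 2) ⊓ (unitsIncl K (κ.layer 2)).range) = 1) :
    (∀ m, classGroupPRank κ m ≤ 1) ∧ ClassicalMuVanishes κ ∧ classicalLambda κ ≤ 1 :=
  classGroupPRank_le_one_of_relIndex_unitsNorm_eq_one_of_forall_odd_ramificationIdx hK κ hκ
    (forall_odd_ramificationIdx_of_not_dvd_discr hd) hh he1 h2 hidx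

end Literature.NumberTheory.IwasawaTheory

end
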